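import Mathlib
import Literature.Analysis.Convex.InfDistConvex
import HarnessLib

/-!
# Error bounds from the geometry of primal–dual sublevel sets
# (Xiong–Freund, *The role of level-set geometry on the performance of PDHG for conic linear
# optimization*, arXiv:2406.01942 (2024), §3.1 Lemma 3.2 and §3.2.1 Lemma 3.12)

Topic `Literature/Analysis/Convex` (companion of `PrimalDualRestartSharpness.lean`, whose section
"Sharpness with slack" types [XiongFreund2024, Theorem 3.5]: restarted primal–dual methods need the
error bound `dist(z, Z*) ≤ L·ρ(z) + C'` only up to a slack `C'`; THIS file supplies the convex
geometry that produces such `L` and `C'` for conic linear programs). Namespace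
`Literature.Analysis.Convex.SublevelSetGeometry`. Everything is PROVED; no named facts.

THE PRINTED SETTING [XiongFreund2024, §2.1 and §3.1, pp. 6–7 and 12–14, read at the page]. For the
conic program `min cᵀx : Ax = b, x ∈ K_p` with dual slack `s ∈ K_d = K_p^*`, the primal–dual pairs
`w = (x, s)` live in `ℝ^{2n}`; `V = V_p × V_d` is the AFFINE set of pairs satisfying the linear
constraints, `K = K_p × K_d` the cone, `F = V ∩ K` the feasible set, `Gap(w) = cᵀx + qᵀs − q₀` the
(affine) duality gap, which after the normalization `c ∈ Null(A)` is INVARIANT under the orthogonal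
projection onto `V` (`Gap(P_V w) = Gap(w)`, used in the proofs of Lemmas 3.9 and 3.12);
`W_δ = F ∩ {Gap ≤ δ}` the `δ`-sublevel set [Def. 3.1] (`W_0 = W*` the optimal set), `D_δ` its
diameter [Def. 3.2], `(w_δ, r_δ)` its conic center and radius — a point of `W_δ` with
`B(w_δ, r_δ) ⊆ K` [Def. 3.3] — and `d^H_δ = max_{w ∈ W_δ} Dist(w, W*)` the Hausdorff distance to the
optimal set [Def. 3.4].

WHAT IS TYPED (abstract, in a real inner product space `E`; every printed object is a parameter with
exactly the property the proofs use, so the statements apply verbatim to `E = ℝ^{2n}` and to ANY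
`(w_δ, r)` with `B(w_δ, r) ⊆ K`, any bound `D` on the diameter of `W_δ` and any bound `d^H` on
`sup_{W_δ} Dist(·, W*)` — in particular to the maximisers of Definitions 3.2–3.4):

* `exists_first_mem_segment` — the point `F(w; w_int)` of [XiongFreund2024, (3.6)]: the first point
  of the segment from `w` to `w_int ∈ K` lying in the closed set `K`, as a parameter `l ∈ [0, 1]`.
* `closedBall_convexComb_subset`, `first_mem_ratio` — the heart of [XiongFreund2024, Lemma 3.2,
  second inequality of (3.7) = (3.13)]: if `B(w_int, r) ⊆ K` (`K` convex) and `v = (1−l)w + l·w_int`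
  is that first point, then `l·r ≤ (1 − l)·Dist(w, K)`, i.e. `‖w − v‖/‖w_int − v‖ ≤ Dist(w, K)/r`.
  (The paper argues with a supporting hyperplane of `K` at `v`; we use the equivalent ball-convexity
  argument — `K ⊇ conv(B(w_int, r) ∪ {u})` contains a ball of radius `μr` around `(1−μ)u + μ w_int`
  for every `u ∈ K` — which needs no interior/separation theorem and gives the same inequality.)
* **`infDist_inter_mul_le`** = [XiongFreund2024, Lemma 3.2]: for convex `S` (in print
  `S = V ∩ {Gap ≤ δ}`), closed convex `K`, `w, w_δ ∈ S`, `B(w_δ, r) ⊆ K`, `r > 0`, and any `D` bounding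
  the distances in `S ∩ K` (= `W_δ`): `Dist(w, S ∩ K) · r ≤ D · Dist(w, K)` — "`D_δ/r_δ` is an error
  bound for `W_δ`"; `infDist_sublevel_mul_le` is the printed instance.
* `le_of_convexOn_of_le` = [XiongFreund2024, Proposition 3.10] (with the hypothesis `u > 0` that its
  proof uses: for `u = 0` the printed statement is false, e.g. `f(t) = t`, `g = 0`).
* `affSet U v₀ = v₀ + U`, `projAff` (the orthogonal projection onto it, via Mathlib's
  `Submodule.starProjection`), `norm_sub_projAff_le_infDist`; `sublevel V K gap δ = V ∩ K ∩ {gap ≤ δ}`.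
* **`infDist_sublevel_zero_le`** = [XiongFreund2024, Lemma 3.12]: with `V = v₀ + U`, closed convex
  `K`, an affine gap `gap(w) = φ(w) + γ₀` whose linear part VANISHES on `Uᗮ` (the printed
  `c ∈ Null(A)`, `q ∈ Im(Aᵀ)`), `W_δ ∋ w_δ` with `B(w_δ, r) ⊆ K`, `D` bounding distances in `W_δ`,
  `W_0 ≠ ∅` and `Dist(u, W_0) ≤ d^H` for `u ∈ W_δ` (`δ > 0`): for EVERY `w ∈ E`,
  `Dist(w, W_0) ≤ (2D/r + 1) · max{Dist(w, V), Dist(w, K)} + (d^H/δ) · max{gap(w), δ}`,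
  and the printed `3D/r` form under `r ≤ D` (`infDist_sublevel_zero_le_three`; in print `D_δ ≥ r_δ`
  is Lemma 3.1). Proof as printed: the case `gap(w) ≤ δ` via `ŵ = P_V(w)`, Lemma 3.2 at `ŵ`, the
  Lipschitz property of `Dist(·, W_0)` and the Hausdorff bound (`infDist_sublevel_zero_le_of_gap_le`);
  the case `gap(w) > δ` by scaling along the segment from (a near-) nearest point `w* ∈ W_0` to `w` at
  the parameter `u = δ/gap(w)` — the convexity of `Dist(·, V)`, `Dist(·, K)`
  (`Literature.Analysis.Convex.convexOn_infDist`) and the linearity of `gap` and of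
  `t ↦ Dist(w* + t(w − w*), W_0)` on `[0, 1]`, which is the content of Proposition 3.10 there.

Deviations from print, all inessential: (a) `W* := W_0 = F ∩ {gap ≤ 0}` (in print `gap ≥ 0` on `F`
by weak duality, so `W_0 = F ∩ {gap = 0}`; only `gap ≤ 0` on `W*` is used); (b) the conic
center/radius, `D_δ` and `d^H_δ` enter as arbitrary admissible data rather than as maximisers, which
is how the proofs use them; (c) near-nearest points replace exact projections onto `W*` and `W_δ`
(no closedness of `W*` needed); (d) Lemma 3.2's hyperplane step replaced by ball convexity (above).

Deliberately NOT here: Lemma 3.1 (`D_δ ≥ d^H_δ > r_δ > 0`, which uses complementarity `W* ⊆ ∂K` and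
Assumption 1), Lemmas 3.6–3.9, 3.11, 3.13 and Theorem 3.3 (the PDHG-specific translation between the
normalized duality gap and `Dist(·, V)`, `Dist(·, K)`, `Gap`, which lives with
`RestartedPDHG.lean`), the LP refinement of §4 and the central-path bounds of §5.
-/

noncomputable section

namespace Literature.Analysis.Convex.SublevelSetGeometry

open Metric Set
open scoped RealInnerProductSpace

variable {E : Type*} [NormedAddCommGroup E] [InnerProductSpace ℝ E]

/-! ### The first point of a segment in a closed set ([XiongFreund2024, (3.6)]) -/

/-- **The point `F(w; w_int)`** [XiongFreund2024, (3.6)]: for a closed set `K`, any `w` and any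
`w_int ∈ K`, the segment `μ ↦ w + μ(w_int − w)` has a FIRST parameter `l ∈ [0, 1]` whose point lies in
`K`; all earlier points lie outside `K`. [cite: XiongFreund2024, §3.1 display (3.6)] -/
theorem exists_first_mem_segment {K : Set E} (hK : IsClosed K) (w : E) {w' : E} (hw' : w' ∈ K) :
    ∃ l : ℝ, 0 ≤ l ∧ l ≤ 1 ∧ w + l • (w' - w) ∈ K ∧
      ∀ μ : ℝ, 0 ≤ μ → μ < l → w + μ • (w' - w) ∉ K := by
  set S : Set ℝ := {l | l ∈ Icc (0 : ℝ) 1 ∧ w + l • (w' - w) ∈ K} with hS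
  have hcont : Continuous fun l : ℝ => w + l • (w' - w) := by fun_prop
  have hSc : IsClosed S := isClosed_Icc.inter (hK.preimage hcont)
  have h1S : (1 : ℝ) ∈ S := ⟨⟨zero_le_one, le_rfl⟩, by simpa using hw'⟩
  have hSne : S.Nonempty := ⟨1, h1S⟩
  have hSbdd : BddBelow S := ⟨0, fun l hl => hl.1.1⟩
  have hlS : sInf S ∈ S := hSc.csInf_mem hSne hSbdd
  refine ⟨sInf S, hlS.1.1, hlS.1.2, hlS.2, fun μ hμ0 hμl hμK => ?_⟩
  have hμS : μ ∈ S := ⟨⟨hμ0, hμl.le.trans hlS.1.2⟩, hμK⟩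
  exact absurd (csInf_le hSbdd hμS) (not_le.mpr hμl)

/-! ### Lemma 3.2: `D_δ / r_δ` is an error bound for `W_δ` -/

/-- Ball convexity: if `B(w', r) ⊆ K`, `u ∈ K` and `K` is convex, then for `μ ∈ [0, 1]` the ball of
radius `μ r` around `(1 − μ)u + μ w'` lies in `K` (`K ⊇ (1−μ){u} + μ B(w', r)`). This replaces the
supporting-hyperplane step (3.9)–(3.12) of the printed proof. [cite: XiongFreund2024, Lemma 3.2 (proof, (3.12): B(w_δ, r_δ) ⊆ K)] -/
theorem closedBall_convexComb_subset {K : Set E} (hKc : Convex ℝ K) {u w' : E} (hu : u ∈ K)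
    {r : ℝ} (hball : closedBall w' r ⊆ K) {μ : ℝ} (hμ0 : 0 ≤ μ) (hμ1 : μ ≤ 1) :
    closedBall ((1 - μ) • u + μ • w') (μ * r) ⊆ K := by
  intro p hp
  rw [mem_closedBall, dist_eq_norm] at hp
  rcases hμ0.eq_or_lt with h0 | hμpos
  · -- `μ = 0`: the ball is the point `u`
    subst h0
    have hp0 : ‖p - u‖ ≤ 0 := by simpa using hp
    have hpu : p = u := by rwa [norm_le_zero_iff, sub_eq_zero] at hp0
    rw [hpu]
    simpa using hu
  · set c := (1 - μ) • u + μ • w' with hc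
    set q := w' + μ⁻¹ • (p - c) with hq
    have hqK : q ∈ K := by
      refine hball ?_
      rw [mem_closedBall, dist_eq_norm, hq, add_sub_cancel_left, norm_smul,
        Real.norm_of_nonneg (inv_nonneg.mpr hμ0), inv_mul_le_iff₀ hμpos]
      exact hp
    have hp_eq : p = (1 - μ) • u + μ • q := by
      rw [hq, smul_add, smul_smul, mul_inv_cancel₀ hμpos.ne', one_smul, hc]
      abel
    rw [hp_eq]
    exact hKc hu hqK (by linarith) hμ0 (by ring)

/-- **The second inequality of [XiongFreund2024, Lemma 3.2, (3.7)] (= (3.13))**: if `B(w', r) ⊆ K`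
(`K` convex, `r > 0`) and `l ∈ [0, 1]` is the first parameter at which the segment from `w` to `w'`
enters `K`, then `l · r ≤ (1 − l) · Dist(w, K)` — i.e. `‖w − v‖ / ‖w' − v‖ ≤ Dist(w, K) / r` for the
entry point `v = w + l(w' − w)`. [cite: XiongFreund2024, Lemma 3.2 ((3.7), second inequality)] -/
theorem first_mem_ratio {K : Set E} (hKc : Convex ℝ K) {w w' : E} {r : ℝ} (hr : 0 < r)
    (hball : closedBall w' r ⊆ K) {l : ℝ} (hl0 : 0 ≤ l) (hl1 : l ≤ 1)
    (hfirst : ∀ μ : ℝ, 0 ≤ μ → μ < l → w + μ • (w' - w) ∉ K) :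
    l * r ≤ (1 - l) * infDist w K := by
  have hKne : K.Nonempty := ⟨w', hball (mem_closedBall_self hr.le)⟩
  set d := infDist w K with hd
  have hd0 : 0 ≤ d := infDist_nonneg
  -- for `μ ∈ [0, l)` and `u ∈ K`: `μ r ≤ (1 − μ) ‖w − u‖`, else the point at `μ` would lie in `K`
  have step : ∀ μ : ℝ, 0 ≤ μ → μ < l → ∀ u ∈ K, μ * r ≤ (1 - μ) * ‖w - u‖ := by
    intro μ hμ0 hμl u hu
    by_contra hlt
    push Not at hlt
    have hμ1 : μ ≤ 1 := hμl.le.trans hl1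
    refine hfirst μ hμ0 hμl (closedBall_convexComb_subset hKc hu hball hμ0 hμ1 ?_)
    rw [mem_closedBall, dist_eq_norm]
    have e : w + μ • (w' - w) - ((1 - μ) • u + μ • w') = (1 - μ) • (w - u) := by
      simp only [smul_sub, sub_smul, one_smul]
      abel
    rw [e, norm_smul, Real.norm_of_nonneg (by linarith)]
    exact hlt.le
  -- hence `μ r ≤ (1 − μ) d` for `μ ∈ [0, l)`
  have step2 : ∀ μ : ℝ, 0 ≤ μ → μ < l → μ * r ≤ (1 - μ) * d := by
    intro μ hμ0 hμl
    have h1μ : 0 < 1 - μ := by linarith [hμl.le.trans hl1, hμl]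
    by_contra hlt
    push Not at hlt
    have hlt' : d < μ * r / (1 - μ) := by rw [lt_div_iff₀ h1μ]; linarith
    obtain ⟨u, hu, hwu⟩ := (infDist_lt_iff hKne).mp hlt'
    rw [dist_eq_norm, lt_div_iff₀ h1μ] at hwu
    have := step μ hμ0 hμl u hu
    linarith
  -- let `μ → l`
  rcases hl0.eq_or_lt with h0 | hlpos
  · rw [← h0]; simp [hd0]
  by_contra hlt
  push Not at hlt
  have hrd : 0 < r + d := by linarith
  have hlo : d / (r + d) < l := by
    rw [div_lt_iff₀ hrd]
    nlinarith
  set μ := (d / (r + d) + l) / 2 with hμ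
  have hq0 : 0 ≤ d / (r + d) := by positivity
  have hμ0 : 0 ≤ μ := by rw [hμ]; linarith
  have hμl : μ < l := by rw [hμ]; linarith
  have hμgt : d / (r + d) < μ := by rw [hμ]; linarith
  have h := step2 μ hμ0 hμl
  rw [div_lt_iff₀ hrd] at hμgt
  nlinarith

/-- **[XiongFreund2024, Lemma 3.2] — `D_δ/r_δ` is an error bound for the sublevel set.** Let `K` be
closed and convex, `S` convex (in print `S = V ∩ {Gap ≤ δ}`, so that `S ∩ K = W_δ`), `w, w_δ ∈ S`,
`B(w_δ, r) ⊆ K` with `r > 0`, and let `D` bound the pairwise distances in `S ∩ K`. Then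
`Dist(w, S ∩ K) · r ≤ D · Dist(w, K)` — the chain (3.7):
`Dist(w, W_δ) ≤ ‖w − F(w; w_δ)‖ ≤ (‖w_δ − F(w; w_δ)‖ / r_δ) · Dist(w, K) ≤ (D_δ/r_δ) · Dist(w, K)`
(the case `w ∈ K` is `l = 0`). [cite: XiongFreund2024, Lemma 3.2] -/
theorem infDist_inter_mul_le {K S : Set E} (hK : IsClosed K) (hKc : Convex ℝ K)
    (hS : Convex ℝ S) {w wδ : E} (hw : w ∈ S) (hwδ : wδ ∈ S) {r : ℝ} (hr : 0 < r)
    (hball : closedBall wδ r ⊆ K) {D : ℝ} (hD : ∀ u ∈ S ∩ K, ∀ v ∈ S ∩ K, dist u v ≤ D) :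
    infDist w (S ∩ K) * r ≤ D * infDist w K := by
  have hwδK : wδ ∈ K := hball (mem_closedBall_self hr.le)
  obtain ⟨l, hl0, hl1, hvK, hfirst⟩ := exists_first_mem_segment hK w hwδK
  set v := w + l • (wδ - w) with hv
  have hvS : v ∈ S := by
    have e : v = (1 - l) • w + l • wδ := by
      rw [hv, smul_sub, sub_smul, one_smul]
      abel
    rw [e]
    exact hS hw hwδ (by linarith) hl0 (by ring)
  have hratio : l * r ≤ (1 - l) * infDist w K := first_mem_ratio hKc hr hball hl0 hl1 hfirst
  have h1 : infDist w (S ∩ K) ≤ l * ‖wδ - w‖ := by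
    have hvSK : v ∈ S ∩ K := ⟨hvS, hvK⟩
    have h := infDist_le_dist_of_mem (x := w) hvSK
    rw [dist_eq_norm, hv] at h
    have e : w - (w + l • (wδ - w)) = -(l • (wδ - w)) := by abel
    rw [e, norm_neg, norm_smul, Real.norm_of_nonneg hl0] at h
    exact h
  have h2 : (1 - l) * ‖wδ - w‖ ≤ D := by
    have h := hD wδ ⟨hwδ, hwδK⟩ v ⟨hvS, hvK⟩
    rw [dist_eq_norm, hv] at h
    have e : wδ - (w + l • (wδ - w)) = (1 - l) • (wδ - w) := by
      rw [sub_smul, one_smul, smul_sub]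
      abel
    rw [e, norm_smul, Real.norm_of_nonneg (by linarith)] at h
    exact h
  have hn : 0 ≤ ‖wδ - w‖ := norm_nonneg _
  have hd : 0 ≤ infDist w K := infDist_nonneg
  calc infDist w (S ∩ K) * r ≤ l * ‖wδ - w‖ * r := by gcongr
    _ = ‖wδ - w‖ * (l * r) := by ring
    _ ≤ ‖wδ - w‖ * ((1 - l) * infDist w K) := mul_le_mul_of_nonneg_left hratio hn
    _ = (1 - l) * ‖wδ - w‖ * infDist w K := by ring
    _ ≤ D * infDist w K := mul_le_mul_of_nonneg_right h2 hd

/-- [XiongFreund2024, Lemma 3.2] in ratio form: `Dist(w, S ∩ K) ≤ (D/r) · Dist(w, K)`.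
[cite: XiongFreund2024, Lemma 3.2 ((3.7), outer inequality)] -/
theorem infDist_inter_le_div_mul {K S : Set E} (hK : IsClosed K) (hKc : Convex ℝ K)
    (hS : Convex ℝ S) {w wδ : E} (hw : w ∈ S) (hwδ : wδ ∈ S) {r : ℝ} (hr : 0 < r)
    (hball : closedBall wδ r ⊆ K) {D : ℝ} (hD : ∀ u ∈ S ∩ K, ∀ v ∈ S ∩ K, dist u v ≤ D) :
    infDist w (S ∩ K) ≤ D / r * infDist w K := by
  rw [div_mul_eq_mul_div, le_div_iff₀ hr]
  exact infDist_inter_mul_le hK hKc hS hw hwδ hr hball hD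

/-! ### Proposition 3.10 -/

/-- **[XiongFreund2024, Proposition 3.10]** (as used): on `[0, ∞)` let `g` be convex and `f` affine
with `f(0) = g(0)`; if `g(u) ≥ f(u)` at some `u > 0` then `g(v) ≥ f(v)` for every `v ≥ u`
(`F = g − f` is convex, `F(0) = 0 ≤ F(u)`, and `u` lies between `0` and `v`). The printed hypothesis
reads `u ≥ 0`; the proof divides by `u/v`, and for `u = 0` the claim fails (`f(t) = t`, `g = 0`), so
`u > 0` is the statement actually proved and used (at `u = γ/Gap(w)`, `δ/Gap(w) > 0`).
[cite: XiongFreund2024, Proposition 3.10] -/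
theorem le_of_convexOn_of_le {f g : ℝ → ℝ} (hg : ConvexOn ℝ (Ici (0 : ℝ)) g) {m : ℝ}
    (hf : ∀ t, f t = m * t + f 0) (h0 : f 0 = g 0) {u v : ℝ} (hu : 0 < u) (huv : u ≤ v)
    (hfu : f u ≤ g u) : f v ≤ g v := by
  rcases huv.eq_or_lt with rfl | huv'
  · exact hfu
  have hv : 0 < v := hu.trans huv'
  have hv0 : v ≠ 0 := hv.ne'
  -- convexity of `g` between `0` and `v` at the point `u = (1 − u/v)·0 + (u/v)·v`
  have ha : (0 : ℝ) ≤ 1 - u / v := by rw [sub_nonneg, div_le_one hv]; exact huv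
  have hb : (0 : ℝ) ≤ u / v := by positivity
  have hcomb := hg.2 (mem_Ici.mpr (le_refl (0 : ℝ))) (mem_Ici.mpr hv.le) ha hb (by ring)
  have e : (1 - u / v) • (0 : ℝ) + (u / v) • v = u := by
    rw [smul_zero, zero_add, smul_eq_mul, div_mul_cancel₀ u hv0]
  rw [e, smul_eq_mul, smul_eq_mul] at hcomb
  -- `f` is affine: `f u = (1 − u/v) f 0 + (u/v) f v`
  have hfuv : f u = (1 - u / v) * g 0 + u / v * f v := by
    rw [hf u, hf v, h0]
    field_simp
    ring
  have hquot : 0 < u / v := by positivity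
  -- `(u/v) (g v − f v) ≥ g u − f u ≥ 0`
  have h1 : u / v * f v ≤ u / v * g v := by linarith [hcomb, hfuv, hfu]
  exact le_of_mul_le_mul_left h1 hquot

/-! ### The affine feasibility set `V = v₀ + U`, its orthogonal projection, and the sublevel sets -/

/-- The affine set `V = v₀ + U` (in print `V = V_p × V_d = {Ax = b} × (c + Im Aᵀ)`).
[cite: XiongFreund2024, §2.1 display (2.2)] -/
def affSet (U : Submodule ℝ E) (v₀ : E) : Set E := {w | w - v₀ ∈ U}

/-- Membership in `V = v₀ + U`. [cite: XiongFreund2024, §2.1 display (2.2)] -/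
theorem mem_affSet_iff (U : Submodule ℝ E) (v₀ w : E) :
    w ∈ affSet U v₀ ↔ w - v₀ ∈ U := Iff.rfl

/-- `v₀ ∈ V`. [cite: XiongFreund2024, §2.1 display (2.2)] -/
theorem base_mem_affSet (U : Submodule ℝ E) (v₀ : E) : v₀ ∈ affSet U v₀ := by
  simp [affSet]

/-- `V` is convex. [cite: XiongFreund2024, §2.1 display (2.2)] -/
theorem convex_affSet (U : Submodule ℝ E) (v₀ : E) : Convex ℝ (affSet U v₀) := by
  intro a ha b hb s t hs ht hst
  simp only [affSet, mem_setOf_eq] at ha hb ⊢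
  have e : s • a + t • b - v₀ = s • (a - v₀) + t • (b - v₀) := by
    calc s • a + t • b - v₀ = s • a + t • b - (s + t) • v₀ := by rw [hst, one_smul]
      _ = s • (a - v₀) + t • (b - v₀) := by
          simp only [add_smul, smul_sub]
          abel
  rw [e]
  exact U.add_mem (U.smul_mem s ha) (U.smul_mem t hb)

/-- **The orthogonal projection onto `V = v₀ + U`**, `P_V(w) = v₀ + P_U(w − v₀)`.
[cite: XiongFreund2024, Lemma 3.12 (proof: ŵ := P_V(w))] -/
def projAff (U : Submodule ℝ E) [U.HasOrthogonalProjection] (v₀ w : E) : E :=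
  v₀ + U.starProjection (w - v₀)

/-- `P_V(w) ∈ V`. [cite: XiongFreund2024, Lemma 3.12 (proof: ŵ ∈ V)] -/
theorem projAff_mem (U : Submodule ℝ E) [U.HasOrthogonalProjection] (v₀ w : E) :
    projAff U v₀ w ∈ affSet U v₀ := by
  show v₀ + U.starProjection (w - v₀) - v₀ ∈ U
  rw [add_sub_cancel_left]
  exact U.starProjection_apply_mem (w - v₀)

/-- `w − P_V(w) ⊥ U`. [cite: XiongFreund2024, Lemma 3.12 (proof: c ∈ Null(A) = V⃗_p, q ∈ Im(Aᵀ) = V⃗_d)] -/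
theorem sub_projAff_mem_orthogonal (U : Submodule ℝ E) [U.HasOrthogonalProjection] (v₀ w : E) :
    w - projAff U v₀ w ∈ Uᗮ := by
  have h := U.sub_starProjection_mem_orthogonal (w - v₀)
  have e : w - projAff U v₀ w = w - v₀ - U.starProjection (w - v₀) := by
    simp only [projAff]
    abel
  rw [e]
  exact h

/-- `P_V(w)` is a nearest point of `V`: `‖w − P_V(w)‖ ≤ Dist(w, V)` (Pythagoras against every
`v ∈ V`). [cite: XiongFreund2024, Lemma 3.12 (proof: ‖w − ŵ‖ = Dist(w, V))] -/
theorem norm_sub_projAff_le_infDist (U : Submodule ℝ E) [U.HasOrthogonalProjection] (v₀ w : E) :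
    ‖w - projAff U v₀ w‖ ≤ infDist w (affSet U v₀) := by
  set p := projAff U v₀ w with hp
  have hle : ∀ v ∈ affSet U v₀, ‖w - p‖ ≤ dist w v := by
    intro v hv
    rw [dist_eq_norm]
    have horth : ⟪w - p, p - v⟫ = 0 := by
      have h1 : w - p ∈ Uᗮ := sub_projAff_mem_orthogonal U v₀ w
      have h2 : p - v ∈ U := by
        have hpV : p - v₀ ∈ U := projAff_mem U v₀ w
        have hvV : v - v₀ ∈ U := hv
        have e : p - v = (p - v₀) - (v - v₀) := by abel
        rw [e]
        exact U.sub_mem hpV hvV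
      exact Submodule.inner_left_of_mem_orthogonal h2 h1
    have hpyth : ‖w - p + (p - v)‖ * ‖w - p + (p - v)‖ = ‖w - p‖ * ‖w - p‖ + ‖p - v‖ * ‖p - v‖ :=
      norm_add_sq_eq_norm_sq_add_norm_sq_of_inner_eq_zero _ _ horth
    have e : w - p + (p - v) = w - v := by abel
    rw [e] at hpyth
    have hsq : ‖w - p‖ ^ 2 ≤ ‖w - v‖ ^ 2 := by
      nlinarith [norm_nonneg (p - v), hpyth]
    exact (pow_le_pow_iff_left₀ (norm_nonneg _) (norm_nonneg _) two_ne_zero).mp hsq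
  by_contra hlt
  push Not at hlt
  obtain ⟨v, hv, hwv⟩ := (infDist_lt_iff ⟨v₀, base_mem_affSet U v₀⟩).mp hlt
  exact absurd (hle v hv) (not_le.mpr hwv)

omit [NormedAddCommGroup E] [InnerProductSpace ℝ E] in
/-- **The `δ`-sublevel set** `W_δ = V ∩ K ∩ {gap ≤ δ}` [XiongFreund2024, Definition 3.1]
(`W_0` is the optimal set `W*`). [cite: XiongFreund2024, Definition 3.1] -/
def sublevel (V K : Set E) (gap : E → ℝ) (δ : ℝ) : Set E := {w | w ∈ V ∧ w ∈ K ∧ gap w ≤ δ}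

omit [NormedAddCommGroup E] [InnerProductSpace ℝ E] in
/-- Membership in `W_δ`. [cite: XiongFreund2024, Definition 3.1] -/
theorem mem_sublevel_iff (V K : Set E) (gap : E → ℝ) (δ : ℝ) (w : E) :
    w ∈ sublevel V K gap δ ↔ w ∈ V ∧ w ∈ K ∧ gap w ≤ δ := Iff.rfl

omit [NormedAddCommGroup E] [InnerProductSpace ℝ E] in
/-- `W_δ ⊆ W_δ'` for `δ ≤ δ'` ("for all `δ ≥ 0` we have `W* ⊆ W_δ`").
[cite: XiongFreund2024, §3.1 (after Definition 3.1)] -/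
theorem sublevel_mono (V K : Set E) (gap : E → ℝ) {δ δ' : ℝ} (h : δ ≤ δ') :
    sublevel V K gap δ ⊆ sublevel V K gap δ' :=
  fun _ hw => ⟨hw.1, hw.2.1, hw.2.2.trans h⟩

omit [NormedAddCommGroup E] [InnerProductSpace ℝ E] in
/-- `W_δ = (V ∩ {gap ≤ δ}) ∩ K`. [cite: XiongFreund2024, Definition 3.1] -/
theorem sublevel_eq_inter (V K : Set E) (gap : E → ℝ) (δ : ℝ) :
    sublevel V K gap δ = (V ∩ {w | gap w ≤ δ}) ∩ K := by
  ext w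
  simp only [sublevel, mem_inter_iff, mem_setOf_eq]
  tauto

/-- [XiongFreund2024, Lemma 3.2] for the sublevel set `W_δ` of an affine gap `gap = φ + γ₀` over
`V = v₀ + U`: for `w ∈ V` with `gap(w) ≤ δ`, `w_δ ∈ W_δ` with `B(w_δ, r) ⊆ K` (`r > 0`) and `D`
bounding distances in `W_δ`, `Dist(w, W_δ) · r ≤ D · Dist(w, K)`.
[cite: XiongFreund2024, Lemma 3.2] -/
theorem infDist_sublevel_mul_le (U : Submodule ℝ E) (v₀ : E) {K : Set E} (hK : IsClosed K)
    (hKc : Convex ℝ K) (φ : E →ₗ[ℝ] ℝ) (γ₀ : ℝ) {δ r D : ℝ} {w wδ : E}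
    (hwV : w ∈ affSet U v₀) (hwg : φ w + γ₀ ≤ δ)
    (hwδ : wδ ∈ sublevel (affSet U v₀) K (fun w => φ w + γ₀) δ) (hr : 0 < r)
    (hball : closedBall wδ r ⊆ K)
    (hD : ∀ u ∈ sublevel (affSet U v₀) K (fun w => φ w + γ₀) δ,
      ∀ v ∈ sublevel (affSet U v₀) K (fun w => φ w + γ₀) δ, dist u v ≤ D) :
    infDist w (sublevel (affSet U v₀) K (fun w => φ w + γ₀) δ) * r ≤ D * infDist w K := by
  set S : Set E := affSet U v₀ ∩ {w | φ w + γ₀ ≤ δ} with hS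
  have hSconv : Convex ℝ S := by
    refine (convex_affSet U v₀).inter ?_
    intro a ha b hb s t hs ht hst
    simp only [mem_setOf_eq, map_add, map_smul, smul_eq_mul] at ha hb ⊢
    have h1 : s * (φ a + γ₀) ≤ s * δ := mul_le_mul_of_nonneg_left ha hs
    have h2 : t * (φ b + γ₀) ≤ t * δ := mul_le_mul_of_nonneg_left hb ht
    have e1 : s * φ a + t * φ b + γ₀ = s * (φ a + γ₀) + t * (φ b + γ₀) := by
      calc s * φ a + t * φ b + γ₀ = s * φ a + t * φ b + (s + t) * γ₀ := by rw [hst, one_mul]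
        _ = s * (φ a + γ₀) + t * (φ b + γ₀) := by ring
    have e2 : s * δ + t * δ = δ := by rw [← add_mul, hst, one_mul]
    linarith [h1, h2, e1, e2]
  have hWeq : sublevel (affSet U v₀) K (fun w => φ w + γ₀) δ = S ∩ K :=
    sublevel_eq_inter _ _ _ _
  rw [hWeq] at hwδ hD ⊢
  exact infDist_inter_mul_le hK hKc hSconv ⟨hwV, hwg⟩ hwδ.1 hr hball hD

/-! ### Lemma 3.12: the distance to the optimal set via `D_δ/r_δ` and the Hausdorff term -/

/-- **[XiongFreund2024, Lemma 3.12], the case `gap(w) ≤ δ`** (first half of the printed proof): with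
`V = v₀ + U`, closed convex `K`, affine `gap = φ + γ₀` invariant under `P_V` (`φ = 0` on `Uᗮ`),
`w_δ ∈ W_δ` with `B(w_δ, r) ⊆ K`, `D` bounding distances in `W_δ` and `Dist(u, W_0) ≤ d^H` on `W_δ`:
every `w` with `gap(w) ≤ δ` satisfies
`Dist(w, W_0) ≤ (2D/r + 1) · max{Dist(w, V), Dist(w, K)} + d^H`
((3.58)–(3.60): `ŵ = P_V(w)`, Lemma 3.2 at `ŵ`, `Dist(ŵ, K) ≤ ‖w − ŵ‖ + Dist(w, K)`).
[cite: XiongFreund2024, Lemma 3.12 (proof, (3.58)–(3.60))] -/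
theorem infDist_sublevel_zero_le_of_gap_le (U : Submodule ℝ E) [U.HasOrthogonalProjection] (v₀ : E)
    {K : Set E} (hK : IsClosed K) (hKc : Convex ℝ K) (φ : E →ₗ[ℝ] ℝ) (γ₀ : ℝ)
    (hφ : ∀ u ∈ Uᗮ, φ u = 0) {δ r D dH : ℝ} {wδ : E} (hr : 0 < r)
    (hwδ : wδ ∈ sublevel (affSet U v₀) K (fun w => φ w + γ₀) δ) (hball : closedBall wδ r ⊆ K)
    (hD : ∀ u ∈ sublevel (affSet U v₀) K (fun w => φ w + γ₀) δ,
      ∀ v ∈ sublevel (affSet U v₀) K (fun w => φ w + γ₀) δ, dist u v ≤ D)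
    (hdH : ∀ u ∈ sublevel (affSet U v₀) K (fun w => φ w + γ₀) δ,
      infDist u (sublevel (affSet U v₀) K (fun w => φ w + γ₀) 0) ≤ dH)
    {w : E} (hw : φ w + γ₀ ≤ δ) :
    infDist w (sublevel (affSet U v₀) K (fun w => φ w + γ₀) 0) ≤
      (2 * D / r + 1) * max (infDist w (affSet U v₀)) (infDist w K) + dH := by
  set V := affSet U v₀ with hV
  set Wδ := sublevel V K (fun w => φ w + γ₀) δ with hWδ
  set W0 := sublevel V K (fun w => φ w + γ₀) 0 with hW0
  set m := max (infDist w V) (infDist w K) with hm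
  set p := projAff U v₀ w with hp
  have hD0 : 0 ≤ D := by
    have h := hD wδ hwδ wδ hwδ
    rwa [dist_self] at h
  have hm0 : 0 ≤ m := le_max_of_le_left infDist_nonneg
  -- `ŵ = P_V(w) ∈ V` has the same gap and `‖w − ŵ‖ ≤ Dist(w, V) ≤ m`
  have hpV : p ∈ V := projAff_mem U v₀ w
  have hpgap : φ p + γ₀ = φ w + γ₀ := by
    have h := hφ _ (sub_projAff_mem_orthogonal U v₀ w)
    rw [map_sub, sub_eq_zero] at h
    rw [← hp] at h
    rw [h]
  have hwp : ‖w - p‖ ≤ m := (norm_sub_projAff_le_infDist U v₀ w).trans (le_max_left _ _)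
  -- Lemma 3.2 at `ŵ`: `Dist(ŵ, W_δ) · r ≤ D · Dist(ŵ, K) ≤ D · 2m`
  have h32 : infDist p Wδ * r ≤ D * infDist p K :=
    infDist_sublevel_mul_le U v₀ hK hKc φ γ₀ hpV (by rw [hpgap]; exact hw) hwδ hr hball hD
  have hpK : infDist p K ≤ 2 * m := by
    have h1 : infDist p K ≤ infDist w K + dist p w := infDist_le_infDist_add_dist
    rw [dist_eq_norm, norm_sub_rev] at h1
    linarith [le_max_right (infDist w V) (infDist w K)]
  have hpWδ : infDist p Wδ ≤ 2 * D / r * m := by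
    rw [div_mul_eq_mul_div, le_div_iff₀ hr]
    calc infDist p Wδ * r ≤ D * infDist p K := h32
      _ ≤ D * (2 * m) := mul_le_mul_of_nonneg_left hpK hD0
      _ = 2 * D * m := by ring
  -- the Hausdorff term: `Dist(ŵ, W_0) ≤ Dist(ŵ, W_δ) + dH`
  have hWδne : Wδ.Nonempty := ⟨wδ, hwδ⟩
  have hpW0 : infDist p W0 ≤ infDist p Wδ + dH := by
    refine le_of_forall_pos_le_add fun η hη => ?_
    obtain ⟨u, hu, hpu⟩ := (infDist_lt_iff hWδne).mp (lt_add_of_pos_right (infDist p Wδ) hη)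
    calc infDist p W0 ≤ infDist u W0 + dist p u := infDist_le_infDist_add_dist
      _ ≤ dH + (infDist p Wδ + η) := add_le_add (hdH u hu) hpu.le
      _ = infDist p Wδ + dH + η := by ring
  -- assemble: `Dist(w, W_0) ≤ Dist(ŵ, W_0) + ‖w − ŵ‖`
  have hwW0 : infDist w W0 ≤ infDist p W0 + dist w p := infDist_le_infDist_add_dist
  rw [dist_eq_norm] at hwW0
  calc infDist w W0 ≤ infDist p W0 + ‖w - p‖ := hwW0
    _ ≤ (2 * D / r * m + dH) + m := add_le_add (hpW0.trans (by linarith)) hwp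
    _ = (2 * D / r + 1) * m + dH := by ring

/-- **[XiongFreund2024, Lemma 3.12] — distance to optimal solutions via the sublevel-set geometry and
the Hausdorff distance.** With `V = v₀ + U`, closed convex `K`, an affine gap `gap = φ + γ₀` whose
linear part vanishes on `Uᗮ` (the printed normalization `c ∈ Null(A)`), a level `δ > 0`, a point
`w_δ ∈ W_δ` with `B(w_δ, r) ⊆ K` (`r > 0`), `D` bounding distances in `W_δ`, `W_0 ≠ ∅` and
`Dist(u, W_0) ≤ d^H` for all `u ∈ W_δ`, EVERY `w ∈ E` satisfies
`Dist(w, W_0) ≤ (2D/r + 1) · max{Dist(w, V), Dist(w, K)} + (d^H/δ) · max{gap(w), δ}`.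
The case `gap(w) > δ` as printed: scale along the segment from a (near-)nearest `w* ∈ W_0` to `w` at
`u = δ/gap(w)`, where `Dist(·, V)`, `Dist(·, K)` are convex, `gap` is affine and
`Dist(w* + t(w − w*), W_0) = t · Dist(w, W_0)` on `[0, 1]` (Proposition 3.10's mechanism).
[cite: XiongFreund2024, Lemma 3.12] -/
theorem infDist_sublevel_zero_le (U : Submodule ℝ E) [U.HasOrthogonalProjection] (v₀ : E)
    {K : Set E} (hK : IsClosed K) (hKc : Convex ℝ K) (φ : E →ₗ[ℝ] ℝ) (γ₀ : ℝ)
    (hφ : ∀ u ∈ Uᗮ, φ u = 0) {δ r D dH : ℝ} {wδ : E} (hδ : 0 < δ) (hr : 0 < r)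
    (hwδ : wδ ∈ sublevel (affSet U v₀) K (fun w => φ w + γ₀) δ) (hball : closedBall wδ r ⊆ K)
    (hD : ∀ u ∈ sublevel (affSet U v₀) K (fun w => φ w + γ₀) δ,
      ∀ v ∈ sublevel (affSet U v₀) K (fun w => φ w + γ₀) δ, dist u v ≤ D)
    (hne : (sublevel (affSet U v₀) K (fun w => φ w + γ₀) 0).Nonempty)
    (hdH : ∀ u ∈ sublevel (affSet U v₀) K (fun w => φ w + γ₀) δ,
      infDist u (sublevel (affSet U v₀) K (fun w => φ w + γ₀) 0) ≤ dH)
    (w : E) :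
    infDist w (sublevel (affSet U v₀) K (fun w => φ w + γ₀) 0) ≤
      (2 * D / r + 1) * max (infDist w (affSet U v₀)) (infDist w K) +
        dH / δ * max (φ w + γ₀) δ := by
  have hD0 : 0 ≤ D := by
    have h := hD wδ hwδ wδ hwδ
    rwa [dist_self] at h
  have hA0 : 0 ≤ 2 * D / r + 1 := by positivity
  by_cases hw : φ w + γ₀ ≤ δ
  · rw [max_eq_right hw, div_mul_cancel₀ dH hδ.ne']
    exact infDist_sublevel_zero_le_of_gap_le U v₀ hK hKc φ γ₀ hφ hr hwδ hball hD hdH hw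
  push Not at hw
  have hGpos : 0 < φ w + γ₀ := hδ.trans hw
  rw [max_eq_left hw.le]
  -- the scaling parameter `u = δ / gap(w) ∈ (0, 1)`
  set u := δ / (φ w + γ₀) with hu
  have hu0 : 0 < u := by positivity
  have hu1 : u < 1 := by rw [hu, div_lt_one hGpos]; exact hw
  have h1u : 0 ≤ 1 - u := by linarith
  have huG : u * (φ w + γ₀) = δ := by rw [hu, div_mul_cancel₀ δ hGpos.ne']
  set d := infDist w (sublevel (affSet U v₀) K (fun w => φ w + γ₀) 0) with hd
  set m := max (infDist w (affSet U v₀)) (infDist w K) with hm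
  have hVne : (affSet U v₀).Nonempty := ⟨v₀, base_mem_affSet U v₀⟩
  have hKne : K.Nonempty := ⟨wδ, hwδ.2.1⟩
  -- the scaling argument, against a near-nearest point `w* ∈ W_0`
  refine le_of_forall_pos_le_add fun η hη => ?_
  obtain ⟨ws, hws, hwws⟩ := (infDist_lt_iff hne).mp (lt_add_of_pos_right d (mul_pos hη hu0))
  rw [dist_eq_norm] at hwws
  -- `w_u = w* + u (w − w*) = (1 − u) w* + u w`
  have hwu_conv : ws + u • (w - ws) = (1 - u) • ws + u • w := by
    rw [smul_sub, sub_smul, one_smul]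
    abel
  -- its gap is at most `δ`
  have hgap_wu : φ (ws + u • (w - ws)) + γ₀ ≤ δ := by
    have hws0 : φ ws + γ₀ ≤ 0 := hws.2.2
    have e : φ (ws + u • (w - ws)) + γ₀ = (1 - u) * (φ ws + γ₀) + u * (φ w + γ₀) := by
      rw [map_add, map_smul, map_sub, smul_eq_mul]
      ring
    rw [e, huG]
    nlinarith
  -- case 1 at `w_u`
  have hcase := infDist_sublevel_zero_le_of_gap_le U v₀ hK hKc φ γ₀ hφ hr hwδ hball hD hdH hgap_wu
  -- `max{Dist(w_u, V), Dist(w_u, K)} ≤ u · m` (convexity of the distance functions; `w* ∈ V ∩ K`)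
  have hwsV0 : infDist ws (affSet U v₀) = 0 := infDist_zero_of_mem hws.1
  have hwsK0 : infDist ws K = 0 := infDist_zero_of_mem hws.2.1
  have hconvV : infDist (ws + u • (w - ws)) (affSet U v₀) ≤ u * infDist w (affSet U v₀) := by
    have h := (convexOn_infDist (convex_affSet U v₀) hVne).2 (mem_univ ws) (mem_univ w) h1u hu0.le
      (by ring : (1 - u) + u = 1)
    simp only [smul_eq_mul] at h
    rw [hwsV0, mul_zero, zero_add, ← hwu_conv] at h
    exact h
  have hconvK : infDist (ws + u • (w - ws)) K ≤ u * infDist w K := by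
    have h := (convexOn_infDist hKc hKne).2 (mem_univ ws) (mem_univ w) h1u hu0.le
      (by ring : (1 - u) + u = 1)
    simp only [smul_eq_mul] at h
    rw [hwsK0, mul_zero, zero_add, ← hwu_conv] at h
    exact h
  have hmax_wu : max (infDist (ws + u • (w - ws)) (affSet U v₀)) (infDist (ws + u • (w - ws)) K) ≤
      u * m :=
    max_le (hconvV.trans (mul_le_mul_of_nonneg_left (le_max_left _ _) hu0.le))
      (hconvK.trans (mul_le_mul_of_nonneg_left (le_max_right _ _) hu0.le))
  -- `Dist(w_u, W_0) ≥ u d − (1 − u) η u`, since `dist(w, w_u) = (1 − u) ‖w − w*‖ < (1 − u)(d + η u)`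
  have hdist_wwu : dist w (ws + u • (w - ws)) = (1 - u) * ‖w - ws‖ := by
    rw [dist_eq_norm]
    have e : w - (ws + u • (w - ws)) = (1 - u) • (w - ws) := by
      rw [sub_smul, one_smul]
      abel
    rw [e, norm_smul, Real.norm_of_nonneg h1u]
  have hlow : u * d - (1 - u) * (η * u) ≤
      infDist (ws + u • (w - ws)) (sublevel (affSet U v₀) K (fun w => φ w + γ₀) 0) := by
    have h1 : d ≤ infDist (ws + u • (w - ws)) (sublevel (affSet U v₀) K (fun w => φ w + γ₀) 0) +
        dist w (ws + u • (w - ws)) := infDist_le_infDist_add_dist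
    rw [hdist_wwu] at h1
    nlinarith [mul_le_mul_of_nonneg_left hwws.le h1u]
  -- combine and divide by `u`
  have h2 : infDist (ws + u • (w - ws)) (sublevel (affSet U v₀) K (fun w => φ w + γ₀) 0) ≤
      (2 * D / r + 1) * (u * m) + dH :=
    hcase.trans (add_le_add (mul_le_mul_of_nonneg_left hmax_wu hA0) le_rfl)
  have e : dH = u * (dH / δ * (φ w + γ₀)) := by
    rw [hu]
    field_simp
  have hmain : u * d ≤ u * ((2 * D / r + 1) * m + dH / δ * (φ w + γ₀) + η) := by
    have hηu : 0 ≤ (1 - u) * (η * u) := mul_nonneg h1u (mul_nonneg hη.le hu0.le)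
    have : u * d ≤ (2 * D / r + 1) * (u * m) + dH + (1 - u) * (η * u) := by linarith [hlow, h2]
    rw [e] at this
    nlinarith [this, hηu, mul_nonneg hη.le hu0.le]
  exact le_of_mul_le_mul_left hmain hu0

/-- [XiongFreund2024, Lemma 3.12] in the printed form (3.57): when moreover `r ≤ D` (in print
`D_δ ≥ r_δ`, Lemma 3.1), `Dist(w, W_0) ≤ 3(D/r) · max{Dist(w, V), Dist(w, K)} + (d^H/δ) · max{gap(w), δ}`.
[cite: XiongFreund2024, Lemma 3.12 ((3.57))] -/
theorem infDist_sublevel_zero_le_three (U : Submodule ℝ E) [U.HasOrthogonalProjection] (v₀ : E)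
    {K : Set E} (hK : IsClosed K) (hKc : Convex ℝ K) (φ : E →ₗ[ℝ] ℝ) (γ₀ : ℝ)
    (hφ : ∀ u ∈ Uᗮ, φ u = 0) {δ r D dH : ℝ} {wδ : E} (hδ : 0 < δ) (hr : 0 < r) (hrD : r ≤ D)
    (hwδ : wδ ∈ sublevel (affSet U v₀) K (fun w => φ w + γ₀) δ) (hball : closedBall wδ r ⊆ K)
    (hD : ∀ u ∈ sublevel (affSet U v₀) K (fun w => φ w + γ₀) δ,
      ∀ v ∈ sublevel (affSet U v₀) K (fun w => φ w + γ₀) δ, dist u v ≤ D)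
    (hne : (sublevel (affSet U v₀) K (fun w => φ w + γ₀) 0).Nonempty)
    (hdH : ∀ u ∈ sublevel (affSet U v₀) K (fun w => φ w + γ₀) δ,
      infDist u (sublevel (affSet U v₀) K (fun w => φ w + γ₀) 0) ≤ dH)
    (w : E) :
    infDist w (sublevel (affSet U v₀) K (fun w => φ w + γ₀) 0) ≤
      3 * (D / r) * max (infDist w (affSet U v₀)) (infDist w K) +
        dH / δ * max (φ w + γ₀) δ := by
  have h := infDist_sublevel_zero_le U v₀ hK hKc φ γ₀ hφ hδ hr hwδ hball hD hne hdH w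
  have hm0 : 0 ≤ max (infDist w (affSet U v₀)) (infDist w K) := le_max_of_le_left infDist_nonneg
  have hcoef : 2 * D / r + 1 ≤ 3 * (D / r) := by
    rw [div_add_one hr.ne', div_le_iff₀ hr]
    have e : 3 * (D / r) * r = 3 * D := by field_simp
    rw [e]
    linarith
  exact h.trans (add_le_add (mul_le_mul_of_nonneg_right hcoef hm0) le_rfl)

end Literature.Analysis.Convex.SublevelSetGeometry
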